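import Mathlib
import Summits.ValiantsHypothesis.ValiantsHypothesis.Theorems.DivisionGapPerCofactorDegreeReductionStubTwoTowerCollapse
import Summits.ValiantsHypothesis.ValiantsHypothesis.Theorems.DivisionGapPerCofactorDegreeReductionStubAdditiveCreation
import Summits.ValiantsHypothesis.ValiantsHypothesis.Theorems.ZeroOneTransfer.Negative.TopComponentFree
import Literature.Computability.AlgebraicComplexity.ArithCircuitProofs
import Literature.Computability.AlgebraicComplexity.PermanentIrreducible
import Literature.Computability.AlgebraicComplexity.StandardFamiliesProofs

/-!
# Crux `DivisionGap.PerCofactorDegreeReduction` (stmt-ValiantsHypothesis-15046), line `Sketch` —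
# stub `stub_creationCollapse`: the two-tower collapse as a degree reduction with cost

**Theorem (`stub_creationCollapse`).** Let `n ≥ 3`, let `V₁, V₂, u, u' ∈ ℝ≥0[x_ij]` (`n × n`
variables) be nonzero with `deg Vᵢ < N`, and suppose `per_n ∣ V₁ u^N + V₂ u'^N` over `ℝ` (after
`MvPolynomial.map NNReal.toRealHom`).  Then there is a nonzero `A ∈ ℝ≥0[x]` with `per_n ∣ A` over
`ℝ`, `deg A ≤ max (max (deg V₁) (deg V₂)) (max (deg u) (deg u'))` and
`L(A) ≤ L(V₁) + L(V₂) + L(u) + L(u') + 2` (`L = complexity`, fan-in-two size over `ℝ≥0`).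

## Proof

Write `top p` for the top homogeneous component of `p` w.r.t. total degree (the tree's
`topComponent 1 p`; it is free: `complexity_topComponent_le`, multiplicative: `topComponent_mul`,
nonzero for `p ≠ 0`, homogeneous of degree `deg p`).  Let `D = deg (V₁u^N + V₂u'^N)`; over `ℝ≥0`
nothing cancels, so `deg (V₁u^N), deg (V₂u'^N) ≤ D`.
* `per_n` is a form of degree `n`, so `per_n ∣ f` over `ℝ` implies `per_n ∣ f_i` for every
  homogeneous component `f_i` (`perPoly_dvd_homogeneousComponent`), and `map` commutes with
  homogeneous components.  Hence `per_n ∣ (V₁u^N)_D + (V₂u'^N)_D` over `ℝ`.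
* If `deg (V₁u^N) < D = deg (V₂u'^N)`, the first component vanishes and the second is
  `top (V₂u'^N) = top V₂ · (top u')^N`; `per_n` is prime in `ℝ[x]` (`perPoly_prime`), so
  `per_n ∣ top V₂` or `per_n ∣ top u'`: take `A := top V₂` or `A := top u'`.  Symmetrically if
  `deg (V₂u'^N) < D`.  Both degrees `< D` is impossible (`totalDegree_add`).
* If both degrees equal `D`, then `per_n ∣ top V₁ (top u)^N + top V₂ (top u')^N` with all four
  top components homogeneous and `deg (top Vᵢ) = deg Vᵢ < N`: the landed two-tower collapse
  `TwoTowerCollapse.stub_twoTowerCollapse` gives `per_n ∣ top u`, or `per_n ∣ top u'`, or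
  `per_n ∣ c · top V₁ + top V₂`, or `per_n ∣ top u + c · top u'` (`c > 0`); take `A` accordingly.
  Sums with a nonzero summand are nonzero over `ℝ≥0`; `deg` and `L` of `A` are bounded by
  `totalDegree_add`, `totalDegree_smul_le`, `complexity_add_le_holds`, `complexity_smul_le_holds`.

Leans on the tree only: `TwoTowerCollapse.stub_twoTowerCollapse`, `AdditiveCreation.perPoly_prime`,
`ZeroOneTransfer.Negative.{topComponent, topComponent_mul, topComponent_ne_zero, topComponent_C,
complexity_topComponent_le}`, `JerrumSnir.support_add_eq`, `perPoly_isHomogeneous`,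
`complexity_add_le_holds`, `complexity_smul_le_holds`; Mathlib.  No definitions.
-/

noncomputable section

-- `Summit.ValiantsHypothesis.ValiantsHypothesis.…` is the tree's mandated single-conjunct layout
-- (Problem = Summit), so the duplicated namespace component is intended.
set_option linter.dupNamespace false

namespace Summit.ValiantsHypothesis.ValiantsHypothesis.Theorems.DivisionGap.PerCofactorDegreeReduction.CreationCollapse

open MvPolynomial Literature.Computability.AlgebraicComplexity
open Summit.ValiantsHypothesis.ValiantsHypothesis.Theorems.ZeroOneTransfer.Negative
  (topComponent topComponent_mul topComponent_ne_zero topComponent_C complexity_topComponent_le)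
open scoped NNReal BigOperators

/-! ### Homogeneous components: base change and multiples of the permanent -/

/-- `MvPolynomial.map f` commutes with taking homogeneous components. [folklore] -/
theorem map_homogeneousComponent {σ R S : Type*} [CommSemiring R] [CommSemiring S]
    (f : R →+* S) (i : ℕ) (p : MvPolynomial σ R) :
    MvPolynomial.map f (homogeneousComponent i p) =
      homogeneousComponent i (MvPolynomial.map f p) := by
  classical
  ext d
  simp only [coeff_map, coeff_homogeneousComponent]
  split_ifs
  · rfl
  · exact map_zero f

/-- Every homogeneous component of a real multiple of `per_n` is a multiple of `per_n`
(`per_n` is a form of degree `n`). [folklore] -/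
theorem perPoly_dvd_homogeneousComponent {n : ℕ} {g : MvPolynomial (Fin n × Fin n) ℝ}
    (h : perPoly (Fin n) ℝ ∣ g) (i : ℕ) : perPoly (Fin n) ℝ ∣ homogeneousComponent i g := by
  classical
  obtain ⟨q, rfl⟩ := h
  have hper : (perPoly (Fin n) ℝ).IsHomogeneous n := by
    simpa using (perPoly_isHomogeneous (n := Fin n) (k := ℝ))
  conv_rhs => rw [← sum_homogeneousComponent q, Finset.mul_sum, map_sum]
  refine Finset.dvd_sum fun j _ => ?_
  have hhom : (perPoly (Fin n) ℝ * homogeneousComponent j q) ∈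
      homogeneousSubmodule (Fin n × Fin n) ℝ (n + j) :=
    (mem_homogeneousSubmodule _ _).2 (hper.mul (homogeneousComponent_isHomogeneous j q))
  rw [homogeneousComponent_of_mem hhom]
  split_ifs
  · exact dvd_mul_right _ _
  · exact dvd_zero _

/-- `per_n ∣ f` over `ℝ` passes to every homogeneous component of `f ∈ ℝ≥0[x]`. [folklore] -/
theorem perPoly_dvd_map_homogeneousComponent {n : ℕ} {f : MvPolynomial (Fin n × Fin n) ℝ≥0}
    (h : perPoly (Fin n) ℝ ∣ MvPolynomial.map NNReal.toRealHom f) (i : ℕ) :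
    perPoly (Fin n) ℝ ∣ MvPolynomial.map NNReal.toRealHom (homogeneousComponent i f) := by
  rw [map_homogeneousComponent]
  exact perPoly_dvd_homogeneousComponent h i

/-! ### Top components with respect to the total degree -/

/-- For the unit weight the top component is the top homogeneous component. [folklore] -/
theorem topComponent_one_eq {σ : Type*} (p : MvPolynomial σ ℝ≥0) :
    topComponent (1 : σ → ℕ) p = homogeneousComponent p.totalDegree p := by
  unfold topComponent
  rw [weightedTotalDegree_one]
  rfl

/-- The top component of `p` is homogeneous of degree `deg p`. [folklore] -/
theorem topComponent_one_isHomogeneous {σ : Type*} (p : MvPolynomial σ ℝ≥0) :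
    (topComponent (1 : σ → ℕ) p).IsHomogeneous p.totalDegree := by
  rw [topComponent_one_eq]
  exact homogeneousComponent_isHomogeneous _ _

/-- The top component of `p ≠ 0` has the total degree of `p`. [folklore] -/
theorem totalDegree_topComponent_one {σ : Type*} {p : MvPolynomial σ ℝ≥0} (hp : p ≠ 0) :
    (topComponent (1 : σ → ℕ) p).totalDegree = p.totalDegree :=
  (topComponent_one_isHomogeneous p).totalDegree (topComponent_ne_zero 1 hp)

/-- The top component of `p ≠ 0` is homogeneous of its own total degree (the form of homogeneity
consumed by the two-tower collapse). [folklore] -/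
theorem topComponent_one_isHomogeneous_self {σ : Type*} {p : MvPolynomial σ ℝ≥0} (hp : p ≠ 0) :
    (topComponent (1 : σ → ℕ) p).IsHomogeneous (topComponent (1 : σ → ℕ) p).totalDegree := by
  rw [totalDegree_topComponent_one hp]
  exact topComponent_one_isHomogeneous p

/-- Top components of powers: `top (p ^ N) = (top p) ^ N` over `ℝ≥0`. [folklore] -/
theorem topComponent_pow {σ : Type*} (w : σ → ℕ) (p : MvPolynomial σ ℝ≥0) (N : ℕ) :
    topComponent w (p ^ N) = topComponent w p ^ N := by
  induction N with
  | zero => rw [pow_zero, pow_zero, ← C_1, topComponent_C]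
  | succ N ih => rw [pow_succ, pow_succ, topComponent_mul, ih]

/-- The degree-`D` component of a tower `V · v ^ N` of total degree `D` is the tower of top
components `top V · (top v) ^ N`. [folklore] -/
theorem homogeneousComponent_tower {σ : Type*} (V v : MvPolynomial σ ℝ≥0) (N D : ℕ)
    (hD : (V * v ^ N).totalDegree = D) :
    homogeneousComponent D (V * v ^ N) =
      topComponent (1 : σ → ℕ) V * topComponent (1 : σ → ℕ) v ^ N := by
  rw [← hD, ← topComponent_one_eq, topComponent_mul, topComponent_pow]

/-! ### No cancellation over `ℝ≥0` -/

/-- Over `ℝ≥0` a summand's support lies in the support of the sum. [folklore] -/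
theorem support_subset_support_add_left {σ : Type*} (a b : MvPolynomial σ ℝ≥0) :
    a.support ⊆ (a + b).support := by
  classical
  rw [Literature.Barriers.ValiantsHypothesis.JerrumSnir.support_add_eq]
  exact Finset.subset_union_left

/-- Over `ℝ≥0` a summand's support lies in the support of the sum. [folklore] -/
theorem support_subset_support_add_right {σ : Type*} (a b : MvPolynomial σ ℝ≥0) :
    b.support ⊆ (a + b).support := by
  rw [add_comm]
  exact support_subset_support_add_left b a

/-- Over `ℝ≥0` a sum with a nonzero left summand is nonzero. [folklore] -/
theorem add_ne_zero_of_left_ne_zero {σ : Type*} {a : MvPolynomial σ ℝ≥0} (ha : a ≠ 0)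
    (b : MvPolynomial σ ℝ≥0) : a + b ≠ 0 := by
  intro h
  have hsub := support_subset_support_add_left a b
  rw [h, support_zero, Finset.subset_empty, support_eq_empty] at hsub
  exact ha hsub

/-- Over `ℝ≥0` a sum with a nonzero right summand is nonzero. [folklore] -/
theorem add_ne_zero_of_right_ne_zero {σ : Type*} (a : MvPolynomial σ ℝ≥0)
    {b : MvPolynomial σ ℝ≥0} (hb : b ≠ 0) : a + b ≠ 0 := by
  rw [add_comm]
  exact add_ne_zero_of_left_ne_zero hb a

/-! ### Packaging the answers -/

/-- The answer `A := top p`. [folklore] -/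
theorem answer_top {n : ℕ} {p : MvPolynomial (Fin n × Fin n) ℝ≥0} (hp : p ≠ 0) {B L : ℕ}
    (hdeg : p.totalDegree ≤ B) (hcost : complexity p ≤ L)
    (hdvd : perPoly (Fin n) ℝ ∣
      MvPolynomial.map NNReal.toRealHom (topComponent (1 : Fin n × Fin n → ℕ) p)) :
    ∃ A : MvPolynomial (Fin n × Fin n) ℝ≥0, A ≠ 0 ∧
      perPoly (Fin n) ℝ ∣ MvPolynomial.map NNReal.toRealHom A ∧ A.totalDegree ≤ B ∧
      complexity A ≤ L :=
  ⟨topComponent 1 p, topComponent_ne_zero 1 hp, hdvd,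
    (totalDegree_topComponent_one hp).le.trans hdeg, (complexity_topComponent_le 1 p).trans hcost⟩

/-- The answer `A := a + b` (a creation sum). [folklore] -/
theorem answer_add {n : ℕ} {a b : MvPolynomial (Fin n × Fin n) ℝ≥0} (hne : a + b ≠ 0) {B L : ℕ}
    (ha : a.totalDegree ≤ B) (hb : b.totalDegree ≤ B)
    (hcost : complexity a + complexity b + 1 ≤ L)
    (hdvd : perPoly (Fin n) ℝ ∣ MvPolynomial.map NNReal.toRealHom (a + b)) :
    ∃ A : MvPolynomial (Fin n × Fin n) ℝ≥0, A ≠ 0 ∧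
      perPoly (Fin n) ℝ ∣ MvPolynomial.map NNReal.toRealHom A ∧ A.totalDegree ≤ B ∧
      complexity A ≤ L :=
  ⟨a + b, hne, hdvd, (totalDegree_add a b).trans (max_le ha hb),
    (complexity_add_le_holds a b).trans hcost⟩

/-! ### The stub -/

/-- **`stub_creationCollapse` — the two-tower collapse as a degree reduction, with cost.**  A
two-tower creation relation `per_n ∣ V₁u^N + V₂u'^N` over `ℝ` (`n ≥ 3`, all four nonzero and
nonnegative, `deg Vᵢ < N`, no homogeneity assumed) hands over a nonzero nonnegative `A ∈ (per_n)`
of degree at most the tower-base degree `max (max (deg V₁) (deg V₂)) (max (deg u) (deg u'))` and of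
cost `≤ L(V₁) + L(V₂) + L(u) + L(u') + 2`.  Proof: pass to top components (free over `ℝ≥0`), use
that `per_n` is a prime form, and apply `TwoTowerCollapse.stub_twoTowerCollapse` when the two
towers have the same degree. [folklore] -/
theorem stub_creationCollapse (n N : ℕ) (hn : 3 ≤ n)
    (V₁ V₂ u u' : MvPolynomial (Fin n × Fin n) ℝ≥0)
    (hV₁ : V₁ ≠ 0) (hV₂ : V₂ ≠ 0) (hu : u ≠ 0) (hu' : u' ≠ 0)
    (hN₁ : V₁.totalDegree < N) (hN₂ : V₂.totalDegree < N)
    (hdvd : perPoly (Fin n) ℝ ∣ MvPolynomial.map NNReal.toRealHom (V₁ * u ^ N + V₂ * u' ^ N)) :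
    ∃ A : MvPolynomial (Fin n × Fin n) ℝ≥0, A ≠ 0 ∧
      perPoly (Fin n) ℝ ∣ MvPolynomial.map NNReal.toRealHom A ∧
      A.totalDegree ≤ max (max V₁.totalDegree V₂.totalDegree) (max u.totalDegree u'.totalDegree) ∧
      complexity A ≤ complexity V₁ + complexity V₂ + complexity u + complexity u' + 2 := by
  classical
  have hprime : Prime (perPoly (Fin n) ℝ) := AdditiveCreation.perPoly_prime (by omega)
  -- the degree and cost budgets of the four candidate bases
  have hBV₁ : V₁.totalDegree ≤ max (max V₁.totalDegree V₂.totalDegree)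
      (max u.totalDegree u'.totalDegree) := le_max_of_le_left (le_max_left _ _)
  have hBV₂ : V₂.totalDegree ≤ max (max V₁.totalDegree V₂.totalDegree)
      (max u.totalDegree u'.totalDegree) := le_max_of_le_left (le_max_right _ _)
  have hBu : u.totalDegree ≤ max (max V₁.totalDegree V₂.totalDegree)
      (max u.totalDegree u'.totalDegree) := le_max_of_le_right (le_max_left _ _)
  have hBu' : u'.totalDegree ≤ max (max V₁.totalDegree V₂.totalDegree)
      (max u.totalDegree u'.totalDegree) := le_max_of_le_right (le_max_right _ _)
  generalize max (max V₁.totalDegree V₂.totalDegree) (max u.totalDegree u'.totalDegree) = B at *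
  have htV₁ := totalDegree_topComponent_one hV₁
  have htV₂ := totalDegree_topComponent_one hV₂
  have htu := totalDegree_topComponent_one hu
  have htu' := totalDegree_topComponent_one hu'
  have hcV₁ := complexity_topComponent_le (1 : Fin n × Fin n → ℕ) V₁
  have hcV₂ := complexity_topComponent_le (1 : Fin n × Fin n → ℕ) V₂
  have hcu := complexity_topComponent_le (1 : Fin n × Fin n → ℕ) u
  have hcu' := complexity_topComponent_le (1 : Fin n × Fin n → ℕ) u'
  -- the top degree `D` of the relation; both towers have degree `≤ D` (no cancellation)
  obtain ⟨D, hD⟩ : ∃ D, (V₁ * u ^ N + V₂ * u' ^ N).totalDegree = D := ⟨_, rfl⟩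
  have hle₁ : (V₁ * u ^ N).totalDegree ≤ D :=
    (totalDegree_le_of_support_subset (support_subset_support_add_left _ _)).trans_eq hD
  have hle₂ : (V₂ * u' ^ N).totalDegree ≤ D :=
    (totalDegree_le_of_support_subset (support_subset_support_add_right _ _)).trans_eq hD
  -- `per_n` divides the degree-`D` component of the relation
  have hdvdD : perPoly (Fin n) ℝ ∣
      MvPolynomial.map NNReal.toRealHom (homogeneousComponent D (V₁ * u ^ N)) +
        MvPolynomial.map NNReal.toRealHom (homogeneousComponent D (V₂ * u' ^ N)) := by
    have h := perPoly_dvd_map_homogeneousComponent hdvd D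
    rwa [map_add, map_add] at h
  rcases hle₁.lt_or_eq with hlt₁ | heq₁ <;> rcases hle₂.lt_or_eq with hlt₂ | heq₂
  · -- both towers below degree `D`: impossible
    exfalso
    have h := totalDegree_add (V₁ * u ^ N) (V₂ * u' ^ N)
    rw [hD] at h
    exact absurd h (not_le.mpr (max_lt hlt₁ hlt₂))
  · -- only the second tower reaches degree `D`
    rw [homogeneousComponent_eq_zero D _ hlt₁, map_zero, zero_add,
      homogeneousComponent_tower V₂ u' N D heq₂, map_mul, map_pow] at hdvdD
    rcases hprime.dvd_or_dvd hdvdD with h | h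
    · exact answer_top hV₂ hBV₂ (by omega) h
    · exact answer_top hu' hBu' (by omega) (hprime.dvd_of_dvd_pow h)
  · -- only the first tower reaches degree `D`
    rw [homogeneousComponent_eq_zero D _ hlt₂, map_zero, add_zero,
      homogeneousComponent_tower V₁ u N D heq₁, map_mul, map_pow] at hdvdD
    rcases hprime.dvd_or_dvd hdvdD with h | h
    · exact answer_top hV₁ hBV₁ (by omega) h
    · exact answer_top hu hBu (by omega) (hprime.dvd_of_dvd_pow h)
  · -- both towers reach degree `D`: the two-tower collapse on the top components
    rw [homogeneousComponent_tower V₁ u N D heq₁, homogeneousComponent_tower V₂ u' N D heq₂,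
      ← map_add] at hdvdD
    have hcoll := TwoTowerCollapse.stub_twoTowerCollapse n N (topComponent 1 V₁)
      (topComponent 1 V₂) (topComponent 1 u) (topComponent 1 u') hn (topComponent_ne_zero 1 hV₁)
      (topComponent_ne_zero 1 hV₂) (topComponent_one_isHomogeneous_self hV₁)
      (topComponent_one_isHomogeneous_self hV₂) (topComponent_one_isHomogeneous_self hu)
      (topComponent_one_isHomogeneous_self hu') (by omega) (by omega) hdvdD
    rcases hcoll with h | h | ⟨c, -, h⟩ | ⟨c, -, h⟩
    · exact answer_top hu hBu (by omega) h
    · exact answer_top hu' hBu' (by omega) h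
    · refine answer_add (add_ne_zero_of_right_ne_zero _ (topComponent_ne_zero 1 hV₂))
        ((totalDegree_smul_le _ _).trans (by omega)) (by omega) ?_ h
      have := complexity_smul_le_holds c (topComponent (1 : Fin n × Fin n → ℕ) V₁)
      omega
    · refine answer_add (add_ne_zero_of_left_ne_zero (topComponent_ne_zero 1 hu) _)
        (by omega) ((totalDegree_smul_le _ _).trans (by omega)) ?_ h
      have := complexity_smul_le_holds c (topComponent (1 : Fin n × Fin n → ℕ) u')
      omega

end Summit.ValiantsHypothesis.ValiantsHypothesis.Theorems.DivisionGap.PerCofactorDegreeReduction.CreationCollapse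

end
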